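import Summits.FinalStateConjecture.FinalStateConjecture.Theorems.EIHFluxBalanceInertialRecessionStubFirstOrderFrozen
import Summits.FinalStateConjecture.FinalStateConjecture.Theorems.EIHFluxBalanceInertialRecessionStubSlavingCOERMomSlot
import Literature.Geometry.Lorentzian.CoordScalarJet

/-!
# Route EIHFluxBalance — `InertialRecession` (E′), skeleton r13, stub `stub_firstOrderSlaving` (D),
# part 9: the momentum rows of first-order modulated fields — splitting, far bounds,
# `W`-invisibility and translation to the centre

Helper file for the crux `stmt-FinalStateConjecture-17403` (E′), stub (D). Abstract row calculus
over a background field `G` of metric components and variation fields `Vⱼ` near a slice point `x`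
(`(dx⁰) x = t`): the first-order modulated fields are `G_S = G + (x⁰ − t) Σ_{j∈S} Vⱼ`.

* `firstOrder_isMetricOn_modulated` — `G_S` is a field of metric components near `x`;
* `firstOrder_rows_split` — **the rows split over the holes**: by the linearity clause (ML.i),
  `rows(G_S) − rows(G) = Σ_{j∈S} (rows(G_{j}) − rows(G))` (`rows = Ric(♯dx⁰, e)`, `e` spatial);
* `firstOrder_rows_far` — by the bound clause (ML.ii), `|rows(G_{j}) − rows(G)| ≤
  C (1 + ‖DG(x)‖)(‖Vⱼ(x)‖ + ‖DVⱼ(x)‖) ‖dx⁰‖² ‖e‖`;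
* `firstOrder_rows_invisible` — a field with the 2-jet of `G_univ` up to `dx⁰ ⊗ dx⁰ ⊗ W` has the
  same rows (`ricAt_sharp_ker_eq_of_jet₂_along`);
* `firstOrder_rows_translate` — rows of the translated field at the translated event.

Elementary; no definitions, no named facts.
-/

set_option linter.dupNamespace false
set_option maxSynthPendingDepth 3

noncomputable section

open scoped Topology BigOperators
open Filter Set Function Metric Literature.Geometry.Lorentzian Literature.Geometry.Lorentzian.MetricCoord
  Summit.FinalStateConjecture.FinalStateConjecture.Theorems

namespace Summit.FinalStateConjecture.FinalStateConjecture.Theorems.SublinearIsFree.Slaving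

section Rows

variable {ι : Type*} {G : E4 → E4 →L[ℝ] E4 →L[ℝ] ℝ} {V : ι → E4 → E4 →L[ℝ] E4 →L[ℝ] ℝ}
  {U : Set E4} {x : E4} {t : ℝ}

/-- Metric components on an open subset. [folklore] -/
theorem firstOrder_isMetricOn_subset {F : E4 → E4 →L[ℝ] E4 →L[ℝ] ℝ} {W W' : Set E4}
    (h : MetricCoord.IsMetricOn F W) (hW' : IsOpen W') (hsub : W' ⊆ W) :
    MetricCoord.IsMetricOn F W' where
  isOpen := hW'
  contDiffOn := h.contDiffOn.mono hsub
  symm := fun z hz v w ↦ h.symm z (hsub hz) v w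
  isInvertible := fun z hz ↦ h.isInvertible z (hsub hz)

/-- **First-order modulated fields are metric components near the slice point.** If `G` and the
`Vⱼ` are smooth and symmetric on an open `U`, then `G_S = G + (x⁰ − t) Σ_{j∈S} Vⱼ` is a field of
metric components on the open set `U ∩ {G_S invertible}`. [cite: ONeill1983, Ch. 3, Def. 3.1] -/
theorem firstOrder_isMetricOn_modulated (hU : IsOpen U)
    (hG : ∀ z ∈ U, ContDiffAt ℝ ((⊤ : ℕ∞) : WithTop ℕ∞) G z) (hGs : ∀ z v w, G z v w = G z w v)
    (hV : ∀ j, ∀ z ∈ U, ContDiffAt ℝ ((⊤ : ℕ∞) : WithTop ℕ∞) (V j) z)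
    (hVs : ∀ j z v w, V j z v w = V j z w v) (s : Finset ι) (t : ℝ) :
    MetricCoord.IsMetricOn (fun z ↦ G z + ((E4.dx 0) z - t) • ∑ j ∈ s, V j z)
      (U ∩ {z | ((fun z ↦ G z + ((E4.dx 0) z - t) • ∑ j ∈ s, V j z) z).IsInvertible}) := by
  refine firstOrder_isMetricOn_of hU (fun z hz ↦ ?_) (fun z v w ↦ ?_)
  · exact (hG z hz).add ((((E4.dx 0).contDiff.contDiffAt).sub contDiffAt_const).smul
      (ContDiffAt.sum fun j _ ↦ hV j z hz))
  · simp only [add_apply, smul_apply, sum_apply, hGs z v w, hVs _ z v w]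

/-- The modulated field has the value of the background at the slice point. [folklore] -/
theorem firstOrder_modulated_apply (hx : (E4.dx 0) x = t) (s : Finset ι) :
    (fun z ↦ G z + ((E4.dx 0) z - t) • ∑ j ∈ s, V j z) x = G x := by
  simp [hx]

-- the algebraic and the operator-norm instance paths on `E4 →L[ℝ] E4 →L[ℝ] ℝ` unify slowly
set_option synthInstance.maxHeartbeats 200000 in
set_option maxHeartbeats 1600000 in
/-- **The momentum rows of a first-order modulated field split over the variation fields.** Under
the linearity clause (ML.i) of `stub_momRowLinear`: if `G`, `Vⱼ` are smooth and symmetric on an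
open `U ∋ x`, `(dx⁰)x = t`, and `G(x)` is coercive, then for every covector-annihilated `e`
(`(dx⁰) e = 0`), `Ric(G_S)(♯dx⁰, e) − Ric(G)(♯dx⁰, e) = Σ_{j∈S} (Ric(G_{j})(♯dx⁰, e) − Ric(G)(♯dx⁰, e))`
(`♯ = ♯_{G(x)}`; induction on `S`, the jets of `G_S` being `DG + dx⁰ ⊗ Σ Vⱼ(x)` and
`D²G(v) + (dx⁰ v) Σ DVⱼ(x) + dx⁰ ⊗ (Σ DVⱼ(x))(v)`, `firstOrder_modulatedJet`). [folklore] -/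
theorem firstOrder_rows_split [DecidableEq ι]
    (ML₁ : (∀ {G G₁ G₂ G₃ : E4 → E4 →L[ℝ] E4 →L[ℝ] ℝ} {V : Set E4} {x : E4} {n : E4 →L[ℝ] ℝ} {A₁ A₂ : E4 →L[ℝ] E4 →L[ℝ] ℝ} {P₁ P₂ : E4 →L[ℝ] E4 →L[ℝ] E4 →L[ℝ] ℝ} {W₁ W₂ W₃ : E4 →L[ℝ] E4 →L[ℝ] ℝ} (c₁ c₂ : ℝ), MetricCoord.IsMetricOn G V → MetricCoord.IsMetricOn G₁ V → MetricCoord.IsMetricOn G₂ V → MetricCoord.IsMetricOn G₃ V → x ∈ V → G₁ x = G x → G₂ x = G x → G₃ x = G x → fderiv ℝ G₁ x = fderiv ℝ G x + n.smulRight A₁ → fderiv ℝ G₂ x = fderiv ℝ G x + n.smulRight A₂ → fderiv ℝ G₃ x = fderiv ℝ G x + n.smulRight (c₁ • A₁ + c₂ • A₂) → (∀ v, fderiv ℝ (fderiv ℝ G₁) x v = fderiv ℝ (fderiv ℝ G) x v + (n v • P₁ + n.smulRight (P₁ v) + n v • n.smulRight W₁)) → (∀ v, fderiv ℝ (fderiv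 ℝ G₂) x v = fderiv ℝ (fderiv ℝ G) x v + (n v • P₂ + n.smulRight (P₂ v) + n v • n.smulRight W₂)) → (∀ v, fderiv ℝ (fderiv ℝ G₃) x v = fderiv ℝ (fderiv ℝ G) x v + (n v • (c₁ • P₁ + c₂ • P₂) + n.smulRight ((c₁ • P₁ + c₂ • P₂) v) + n v • n.smulRight W₃)) → ∀ e : E4, n e = 0 → MetricCoord.ricAt G₃ x (MetricCoord.sharpAt G x n) e - MetricCoord.ricAt G x (MetricCoord.sharpAt G x n) e = c₁ * (MetricCoord.ricAt G₁ x (MetricCoord.sharpAt G x n) e - MetricCoord.ricAt G x (MetricCoord.sharpAt G x n) e) + c₂ * (MetricCoord.ricAt G₂ x (MetricCoord.sharpAt G x n) e - MetricCoord.ricAt G x (MetricCoord.sharpAt G x n) e)))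
    (hU : IsOpen U) (hxU : x ∈ U) (hx : (E4.dx 0) x = t)
    (hG : ∀ z ∈ U, ContDiffAt ℝ ((⊤ : ℕ∞) : WithTop ℕ∞) G z) (hGs : ∀ z v w, G z v w = G z w v)
    (hV : ∀ j, ∀ z ∈ U, ContDiffAt ℝ ((⊤ : ℕ∞) : WithTop ℕ∞) (V j) z)
    (hVs : ∀ j z v w, V j z v w = V j z w v) {μ : ℝ} (hμ : 0 < μ)
    (hcoer : ∀ v : E4, μ * ‖v‖ ≤ ‖G x v‖) (s : Finset ι) {e : E4} (he : (E4.dx 0) e = 0) :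
    MetricCoord.ricAt (fun z ↦ G z + ((E4.dx 0) z - t) • ∑ j ∈ s, V j z) x
        (MetricCoord.sharpAt G x (E4.dx 0)) e -
      MetricCoord.ricAt G x (MetricCoord.sharpAt G x (E4.dx 0)) e =
    ∑ j ∈ s, (MetricCoord.ricAt (fun z ↦ G z + ((E4.dx 0) z - t) • ∑ j' ∈ ({j} : Finset ι), V j' z) x
        (MetricCoord.sharpAt G x (E4.dx 0)) e -
      MetricCoord.ricAt G x (MetricCoord.sharpAt G x (E4.dx 0)) e) := by
  -- common data
  have hinv : (G x).IsInvertible := firstOrder_isInvertible_of_coercive hμ hcoer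
  have hmet : ∀ s' : Finset ι, MetricCoord.IsMetricOn (fun z ↦ G z + ((E4.dx 0) z - t) • ∑ j ∈ s', V j z)
      (U ∩ {z | ((fun z ↦ G z + ((E4.dx 0) z - t) • ∑ j ∈ s', V j z) z).IsInvertible}) :=
    fun s' ↦ firstOrder_isMetricOn_modulated hU hG hGs hV hVs s' t
  have hxmem : ∀ s' : Finset ι,
      x ∈ U ∩ {z | ((fun z ↦ G z + ((E4.dx 0) z - t) • ∑ j ∈ s', V j z) z).IsInvertible} := fun s' ↦
    ⟨hxU, by show ((fun z ↦ G z + ((E4.dx 0) z - t) • ∑ j ∈ s', V j z) x).IsInvertible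
             rw [firstOrder_modulated_apply hx]; exact hinv⟩
  have hG2 : ContDiffAt ℝ 2 G x := (hG x hxU).of_le (WithTop.coe_le_coe.mpr le_top)
  have hV2 : ∀ s' : Finset ι, ContDiffAt ℝ 2 (fun z ↦ ∑ j ∈ s', V j z) x := fun s' ↦
    (ContDiffAt.sum fun j _ ↦ hV j x hxU).of_le (WithTop.coe_le_coe.mpr le_top)
  have hVd : ∀ j, DifferentiableAt ℝ (V j) x := fun j ↦ (hV j x hxU).differentiableAt (by simp)
  have hjet := fun s' : Finset ι ↦ firstOrder_modulatedJet (π := E4.dx 0) (G := G)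
    (V := fun z ↦ ∑ j ∈ s', V j z) hx hG2 (hV2 s')
  have hDsum : ∀ s' : Finset ι, fderiv ℝ (fun z ↦ ∑ j ∈ s', V j z) x = ∑ j ∈ s', fderiv ℝ (V j) x :=
    fun s' ↦ fderiv_fun_sum fun j _ ↦ hVd j
  -- the background as the empty modulation
  have hG0 : MetricCoord.IsMetricOn G (U ∩ {z | (G z).IsInvertible}) :=
    firstOrder_isMetricOn_of hU hG hGs
  -- induction on `s`
  induction s using Finset.induction_on with
  | empty =>
    simp only [Finset.sum_empty, smul_zero, add_zero, sub_self]
  | @insert j s hj ih =>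
    rw [Finset.sum_insert hj, ← ih]
    -- the four fields on a common open set
    set W₀ := U ∩ {z | (G z).IsInvertible} with hW₀
    set F₁ := fun z ↦ G z + ((E4.dx 0) z - t) • ∑ j' ∈ s, V j' z with hF₁
    set F₂ := fun z ↦ G z + ((E4.dx 0) z - t) • ∑ j' ∈ ({j} : Finset ι), V j' z with hF₂
    set F₃ := fun z ↦ G z + ((E4.dx 0) z - t) • ∑ j' ∈ insert j s, V j' z with hF₃
    set Wc : Set E4 := W₀ ∩ ((U ∩ {z | (F₁ z).IsInvertible}) ∩ ((U ∩ {z | (F₂ z).IsInvertible}) ∩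
      (U ∩ {z | (F₃ z).IsInvertible}))) with hWc
    have hWo : IsOpen Wc :=
      hG0.isOpen.inter ((hmet s).isOpen.inter ((hmet {j}).isOpen.inter (hmet (insert j s)).isOpen))
    have hxW : x ∈ Wc := ⟨⟨hxU, hinv⟩, hxmem s, hxmem {j}, hxmem (insert j s)⟩
    have m0 : MetricCoord.IsMetricOn G Wc := firstOrder_isMetricOn_subset hG0 hWo fun z hz ↦ hz.1
    have m1 : MetricCoord.IsMetricOn F₁ Wc :=
      firstOrder_isMetricOn_subset (hmet s) hWo fun z hz ↦ hz.2.1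
    have m2 : MetricCoord.IsMetricOn F₂ Wc :=
      firstOrder_isMetricOn_subset (hmet {j}) hWo fun z hz ↦ hz.2.2.1
    have m3 : MetricCoord.IsMetricOn F₃ Wc :=
      firstOrder_isMetricOn_subset (hmet (insert j s)) hWo fun z hz ↦ hz.2.2.2
    obtain ⟨e1, d1, dd1⟩ := hjet s
    obtain ⟨e2, d2, dd2⟩ := hjet {j}
    obtain ⟨e3, d3, dd3⟩ := hjet (insert j s)
    -- jets of the inserted field are the sums
    have hA3 : fderiv ℝ F₃ x = fderiv ℝ G x + (E4.dx 0).smulRight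
        ((1 : ℝ) • (fun z ↦ ∑ j' ∈ s, V j' z) x + (1 : ℝ) • (fun z ↦ ∑ j' ∈ ({j} : Finset ι), V j' z) x) := by
      rw [d3, one_smul, one_smul]
      congr 1
      simp only [Finset.sum_insert hj, Finset.sum_singleton, add_comm]
    have hP3 : ∀ v, fderiv ℝ (fderiv ℝ F₃) x v = fderiv ℝ (fderiv ℝ G) x v +
        ((E4.dx 0) v • ((1 : ℝ) • fderiv ℝ (fun z ↦ ∑ j' ∈ s, V j' z) x +
          (1 : ℝ) • fderiv ℝ (fun z ↦ ∑ j' ∈ ({j} : Finset ι), V j' z) x) +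
        (E4.dx 0).smulRight (((1 : ℝ) • fderiv ℝ (fun z ↦ ∑ j' ∈ s, V j' z) x +
          (1 : ℝ) • fderiv ℝ (fun z ↦ ∑ j' ∈ ({j} : Finset ι), V j' z) x) v) +
        (E4.dx 0) v • (E4.dx 0).smulRight (0 : E4 →L[ℝ] E4 →L[ℝ] ℝ)) := by
      intro v
      rw [dd3 v, one_smul, one_smul, hDsum, hDsum, hDsum, Finset.sum_insert hj, Finset.sum_singleton,
        add_comm (fderiv ℝ (V j) x)]
    have key := ML₁ (G := G) (G₁ := F₁) (G₂ := F₂) (G₃ := F₃) (n := E4.dx 0) 1 1 m0 m1 m2 m3 hxW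
      e1 e2 e3 d1 d2 hA3 dd1 dd2 hP3 e he
    rw [one_mul, one_mul] at key
    exact key.trans (add_comm _ _)

-- the algebraic and the operator-norm instance paths on `E4 →L[ℝ] E4 →L[ℝ] ℝ` unify slowly
set_option synthInstance.maxHeartbeats 200000 in
set_option maxHeartbeats 800000 in
/-- **Far bound for one variation field.** Under the bound clause (ML.ii) of `stub_momRowLinear`
with constant `C = C(μ, ν)`: if `G(x)` is `μ`-coercive with `‖G(x)‖ ≤ ν` then
`|Ric(G_{V})(♯dx⁰, e) − Ric(G)(♯dx⁰, e)| ≤ C (1 + ‖DG(x)‖)(‖V(x)‖ + ‖DV(x)‖) ‖dx⁰‖² ‖e‖`.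
[folklore] -/
theorem firstOrder_rows_far {C μ ν : ℝ}
    (ML₂ : ∀ {G G₁ : E4 → E4 →L[ℝ] E4 →L[ℝ] ℝ} {V : Set E4} {x : E4} {n : E4 →L[ℝ] ℝ} {A : E4 →L[ℝ] E4 →L[ℝ] ℝ} {P : E4 →L[ℝ] E4 →L[ℝ] E4 →L[ℝ] ℝ} {W : E4 →L[ℝ] E4 →L[ℝ] ℝ}, MetricCoord.IsMetricOn G V → MetricCoord.IsMetricOn G₁ V → x ∈ V → (∀ v : E4, μ * ‖v‖ ≤ ‖G x v‖) → ‖G x‖ ≤ ν → G₁ x = G x → fderiv ℝ G₁ x = fderiv ℝ G x + n.smulRight A → (∀ v, fderiv ℝ (fderiv ℝ G₁) x v = fderiv ℝ (fderiv ℝ G) x v + (n v • P + n.smulRight (P v) + n v • n.smulRight W)) → ∀ e : E4, n e = 0 → |MetricCoord.ricAt G₁ x (MetricCoord.sharpAt G x n) e - MetricCoord.ricAt G x (MetricCoord.sharpAt G x n) e| ≤ C * (1 + ‖fderiv ℝ G x‖) * (‖A‖ + ‖P‖) * ‖n‖ ^ 2 * ‖e‖)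
    {V₁ : E4 → E4 →L[ℝ] E4 →L[ℝ] ℝ}
    (hU : IsOpen U) (hxU : x ∈ U) (hx : (E4.dx 0) x = t)
    (hG : ∀ z ∈ U, ContDiffAt ℝ ((⊤ : ℕ∞) : WithTop ℕ∞) G z) (hGs : ∀ z v w, G z v w = G z w v)
    (hV : ∀ z ∈ U, ContDiffAt ℝ ((⊤ : ℕ∞) : WithTop ℕ∞) V₁ z)
    (hVs : ∀ z v w, V₁ z v w = V₁ z w v) (hμ : 0 < μ)
    (hcoer : ∀ v : E4, μ * ‖v‖ ≤ ‖G x v‖) (hν : ‖G x‖ ≤ ν) {e : E4} (he : (E4.dx 0) e = 0) :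
    |MetricCoord.ricAt (fun z ↦ G z + ((E4.dx 0) z - t) • V₁ z) x (MetricCoord.sharpAt G x (E4.dx 0)) e -
      MetricCoord.ricAt G x (MetricCoord.sharpAt G x (E4.dx 0)) e| ≤
    C * (1 + ‖fderiv ℝ G x‖) * (‖V₁ x‖ + ‖fderiv ℝ V₁ x‖) * ‖E4.dx 0‖ ^ 2 * ‖e‖ := by
  have hinv : (G x).IsInvertible := firstOrder_isInvertible_of_coercive hμ hcoer
  have hG0 : MetricCoord.IsMetricOn G (U ∩ {z | (G z).IsInvertible}) := firstOrder_isMetricOn_of hU hG hGs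
  have hmet := firstOrder_isMetricOn_modulated (V := fun _ : Unit ↦ V₁) hU hG hGs (fun _ ↦ hV)
    (fun _ ↦ hVs) Finset.univ t
  simp only [Finset.univ_unique, Finset.sum_singleton] at hmet
  set F₁ := fun z ↦ G z + ((E4.dx 0) z - t) • V₁ z with hF₁
  have hF₁x : F₁ x = G x := by
    show G x + ((E4.dx 0) x - t) • V₁ x = G x
    rw [hx, sub_self, zero_smul, add_zero]
  set Wc : Set E4 := (U ∩ {z | (G z).IsInvertible}) ∩ (U ∩ {z | (F₁ z).IsInvertible}) with hWc
  have hWo : IsOpen Wc := hG0.isOpen.inter hmet.isOpen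
  have hxW : x ∈ Wc := ⟨⟨hxU, hinv⟩, hxU, by show (F₁ x).IsInvertible; rw [hF₁x]; exact hinv⟩
  have m0 : MetricCoord.IsMetricOn G Wc := firstOrder_isMetricOn_subset hG0 hWo fun z hz ↦ hz.1
  have m1 : MetricCoord.IsMetricOn F₁ Wc := firstOrder_isMetricOn_subset hmet hWo fun z hz ↦ hz.2
  have hG2 : ContDiffAt ℝ 2 G x := (hG x hxU).of_le (WithTop.coe_le_coe.mpr le_top)
  have hV2 : ContDiffAt ℝ 2 V₁ x := (hV x hxU).of_le (WithTop.coe_le_coe.mpr le_top)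
  obtain ⟨-, d1, dd1⟩ := firstOrder_modulatedJet (π := E4.dx 0) (G := G) (V := V₁) hx hG2 hV2
  exact ML₂ m0 m1 hxW hcoer hν hF₁x d1 dd1 e he

/-- **`W`-invisibility for the rows**: a field of metric components `H` near `x` with the same value
as `G`, first derivative `DG + dx⁰ ⊗ Σⱼ Vⱼ(x)` and second derivative
`D²G(v) + (dx⁰ v) Σ DVⱼ(x) + dx⁰ ⊗ (Σ DVⱼ(x))(v) + (dx⁰ v) dx⁰ ⊗ W` has the same rows as `G_univ`
(`ricAt_sharp_ker_eq_of_jet₂_along`). [cite: ONeill1983, Ch. 3, Lemma 3.52] -/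
theorem firstOrder_rows_invisible [Fintype ι] {H : E4 → E4 →L[ℝ] E4 →L[ℝ] ℝ} {U' : Set E4}
    {W : E4 →L[ℝ] E4 →L[ℝ] ℝ}
    (hU : IsOpen U) (hxU : x ∈ U) (hx : (E4.dx 0) x = t)
    (hG : ∀ z ∈ U, ContDiffAt ℝ ((⊤ : ℕ∞) : WithTop ℕ∞) G z) (hGs : ∀ z v w, G z v w = G z w v)
    (hV : ∀ j, ∀ z ∈ U, ContDiffAt ℝ ((⊤ : ℕ∞) : WithTop ℕ∞) (V j) z)
    (hVs : ∀ j z v w, V j z v w = V j z w v) {μ : ℝ} (hμ : 0 < μ)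
    (hcoer : ∀ v : E4, μ * ‖v‖ ≤ ‖G x v‖)
    (hU' : IsOpen U') (hxU' : x ∈ U') (hH : ∀ z ∈ U', ContDiffAt ℝ ((⊤ : ℕ∞) : WithTop ℕ∞) H z)
    (hHs : ∀ z v w, H z v w = H z w v)
    (h0 : H x = G x)
    (h1 : fderiv ℝ H x = fderiv ℝ G x + (E4.dx 0).smulRight (∑ j, V j x))
    (h2 : ∀ v, fderiv ℝ (fderiv ℝ H) x v = fderiv ℝ (fderiv ℝ G) x v +
      ((E4.dx 0) v • ∑ j, fderiv ℝ (V j) x + (E4.dx 0).smulRight ((∑ j, fderiv ℝ (V j) x) v) +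
        (E4.dx 0) v • (E4.dx 0).smulRight W)) {e : E4} (he : (E4.dx 0) e = 0) :
    MetricCoord.ricAt H x (MetricCoord.sharpAt G x (E4.dx 0)) e =
      MetricCoord.ricAt (fun z ↦ G z + ((E4.dx 0) z - t) • ∑ j ∈ Finset.univ, V j z) x
        (MetricCoord.sharpAt G x (E4.dx 0)) e := by
  classical
  have hinv : (G x).IsInvertible := firstOrder_isInvertible_of_coercive hμ hcoer
  have hmet := firstOrder_isMetricOn_modulated hU hG hGs hV hVs Finset.univ t
  set F := fun z ↦ G z + ((E4.dx 0) z - t) • ∑ j ∈ Finset.univ, V j z with hF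
  have hFx : F x = G x := firstOrder_modulated_apply hx _
  have hHm : MetricCoord.IsMetricOn H (U' ∩ {z | (H z).IsInvertible}) := firstOrder_isMetricOn_of hU' hH hHs
  set Wc : Set E4 := (U ∩ {z | (F z).IsInvertible}) ∩ (U' ∩ {z | (H z).IsInvertible}) with hWc
  have hWo : IsOpen Wc := hmet.isOpen.inter hHm.isOpen
  have hxW : x ∈ Wc := ⟨⟨hxU, by show (F x).IsInvertible; rw [hFx]; exact hinv⟩,
    hxU', by show (H x).IsInvertible; rw [h0]; exact hinv⟩
  have mF : MetricCoord.IsMetricOn F Wc := firstOrder_isMetricOn_subset hmet hWo fun z hz ↦ hz.1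
  have mH : MetricCoord.IsMetricOn H Wc := firstOrder_isMetricOn_subset hHm hWo fun z hz ↦ hz.2
  have hG2 : ContDiffAt ℝ 2 G x := (hG x hxU).of_le (WithTop.coe_le_coe.mpr le_top)
  have hV2 : ContDiffAt ℝ 2 (fun z ↦ ∑ j ∈ Finset.univ, V j z) x :=
    (ContDiffAt.sum fun j _ ↦ hV j x hxU).of_le (WithTop.coe_le_coe.mpr le_top)
  have hVd : ∀ j, DifferentiableAt ℝ (V j) x := fun j ↦ (hV j x hxU).differentiableAt (by simp)
  obtain ⟨-, d1, dd1⟩ := firstOrder_modulatedJet (π := E4.dx 0) (G := G)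
    (V := fun z ↦ ∑ j ∈ Finset.univ, V j z) hx hG2 hV2
  have hDsum : fderiv ℝ (fun z ↦ ∑ j ∈ Finset.univ, V j z) x = ∑ j, fderiv ℝ (V j) x :=
    fderiv_fun_sum fun j _ ↦ hVd j
  have j0 : H x = F x := by rw [h0, hFx]
  have j1 : fderiv ℝ H x = fderiv ℝ F x := by rw [h1, d1]
  have j2 : ∀ v, fderiv ℝ (fderiv ℝ H) x v = fderiv ℝ (fderiv ℝ F) x v +
      (E4.dx 0) v • (E4.dx 0).smulRight W := by
    intro v
    rw [h2 v, dd1 v, hDsum]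
    have hz : (E4.dx 0).smulRight (0 : E4 →L[ℝ] E4 →L[ℝ] ℝ) = 0 := by ext; simp
    rw [hz, smul_zero, add_zero]
    abel
  have hsharp : MetricCoord.sharpAt G x (E4.dx 0) = MetricCoord.sharpAt F x (E4.dx 0) := by
    simp only [MetricCoord.sharpAt, hFx]
  rw [hsharp]
  exact ricAt_sharp_ker_eq_of_jet₂_along mF mH hxW j0 j1 j2 he

end Rows

/-! ### Translation to the centre -/

section Translate

/-- **Rows of a translated field at the translated event.** For any field `G`, centre `c`,
variation-field pair `V, V'` with `V (z + c) = V' z`, and `c⁰ = t`: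
`Ric(z ↦ G(z + c) + z⁰ V'(z))(x_y)(♯', e) − Ric(z ↦ G(z + c))(x_y)(♯', e) =
Ric(G + (x⁰ − t) V)(x_y + c)(♯, e) − Ric(G)(x_y + c)(♯, e)` with `♯' = ♯_{G(x_y + c)}`
(`MetricCoord.ricAt_comp_add_right`). [cite: ONeill1983, Ch. 3, Lemma 3.52] -/
theorem firstOrder_rows_translate (G : E4 → E4 →L[ℝ] E4 →L[ℝ] ℝ)
    (V V' : E4 → E4 →L[ℝ] E4 →L[ℝ] ℝ) {c : E4} {t : ℝ} (hc : c 0 = t)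
    (hV : ∀ z, V (z + c) = V' z) (xy e : E4) :
    MetricCoord.ricAt (fun z : E4 ↦ (fun z ↦ G (z + c)) z + (z 0) • V' z) xy
        (MetricCoord.sharpAt (fun z ↦ G (z + c)) xy (E4.dx 0)) e -
      MetricCoord.ricAt (fun z ↦ G (z + c)) xy (MetricCoord.sharpAt (fun z ↦ G (z + c)) xy (E4.dx 0)) e =
    MetricCoord.ricAt (fun z ↦ G z + ((E4.dx 0) z - t) • V z) (xy + c)
        (MetricCoord.sharpAt G (xy + c) (E4.dx 0)) e -
      MetricCoord.ricAt G (xy + c) (MetricCoord.sharpAt G (xy + c) (E4.dx 0)) e := by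
  have hfun : (fun z : E4 ↦ (fun z ↦ G (z + c)) z + (z 0) • V' z) =
      fun z ↦ (fun z ↦ G z + ((E4.dx 0) z - t) • V z) (z + c) := by
    funext z
    simp only [hV z, map_add]
    show G (z + c) + (z 0) • V' z = G (z + c) + (z 0 + c 0 - t) • V' z
    rw [hc, add_sub_cancel_right]
  rw [hfun, MetricCoord.ricAt_comp_add_right (fun z ↦ G z + ((E4.dx 0) z - t) • V z) c xy,
    MetricCoord.ricAt_comp_add_right G c xy, MetricCoord.sharpAt_comp_add_right G c xy]

end Translate

/-- **Registered one-line carrier form** (`firstOrder_rows_translate_D9`, stub (D) of the crux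
item) of `firstOrder_rows_translate`. [cite: ONeill1983, Ch. 3, Lemma 3.52] -/
theorem firstOrder_rows_translate_D9 : open Literature.Geometry.Lorentzian in ∀ (G V V' : E4 → E4 →L[ℝ] E4 →L[ℝ] ℝ) {c : E4} {t : ℝ}, c 0 = t → (∀ z, V (z + c) = V' z) → ∀ (xy e : E4), MetricCoord.ricAt (fun z : E4 ↦ (fun z ↦ G (z + c)) z + (z 0) • V' z) xy (MetricCoord.sharpAt (fun z ↦ G (z + c)) xy (E4.dx 0)) e - MetricCoord.ricAt (fun z ↦ G (z + c)) xy (MetricCoord.sharpAt (fun z ↦ G (z + c)) xy (E4.dx 0)) e = MetricCoord.ricAt (fun z ↦ G z + ((E4.dx 0) z - t) • V z) (xy + c) (MetricCoord.sharpAt G (xy + c) (E4.dx 0)) e - MetricCoord.ricAt G (xy + c) (MetricCoord.sharpAt G (xy + c) (E4.dx 0)) e :=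
  fun G V V' _ _ hc hV xy e ↦ firstOrder_rows_translate G V V' hc hV xy e

end Summit.FinalStateConjecture.FinalStateConjecture.Theorems.SublinearIsFree.Slaving

end
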